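import Literature.NumberTheory.EllipticCurves.Kato2004.EulerSystemClasses
import HarnessLib

/-!
# Kato 2004 (Astérisque 295) Thm. 13.4 (2)(3) — the Euler-system bound for a GENUINE Λ-adic
# Euler-system class of `T_pE`, read on the dual FINE Selmer group `X₀(E/ℚ_∞)`, with NO hypothesis
# on the reduction of `E` at `p` — ONE named fact (`def … : Prop`, D-0014; nothing asserted)

Topic `NumberTheory/EllipticCurves`, sub-directory `Kato2004` (namespace = path). Cell `bsd-potss`
(HOME `run/shared/lean/pub/bsd-potss/`), seat `bsd-potss-k8q-c2x` g2 (prover; WIDTH-LEVER second lane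
of item stmt-BirchSwinnertonDyer-19241 `PlusKatoDivisibilityBranch`, rung K8-Gss2 of
`BirchSwinnertonDyer`, route `QuadraticBranchSignedControl`; director-bsd g8 2026-08-27: "Kato
divisibility in the plus theory BY NAME"). HONEST FRAMING (cell bsd-potss): the programme assembles
the Birch–Swinnerton-Dyer formula for analytic-rank `≤ 1` curves STRICTLY from published theorems and
TYPES the remainder; BSD is not proved by any of this; nothing is booked. THIS FILE: one named fact
whose binders are the tree's PINNED objects — the `Δ`-trivial Iwasawa cohomology
`I : Kato2004.IwasawaH1Data W p κ γ` (`𝐇¹_Γ(T_pW)`), a Pontryagin-dual datum of the fine Selmer group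
`FB : W.FineSelmerDualData κ γ` (`X₀(W/ℚ_∞)`), and a GENUINE Λ-adic Euler-system class
`s ∈ 𝐇¹_Γ(T_pW)` (`Kato2004.IsEulerSystemClass W p κ γ I s`, file `EulerSystemClasses`) — stating
Kato's general Euler-system theorem Thm. 13.4 (2)(3) for `T = T_pW` in the printed LENGTH form at the
height-one primes of `Λ = ℤ_p⟦X⟧`. No structure, no instance, no notation, no attribute; no `_holds`
(Kato §13 = Perrin-Riou [Pe4] / Rubin [Ru4] / Kato [KK4]: the Euler-system machinery is not in
Mathlib; size XL).

## Why this file (the gap it fills, and the consumer)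

Every Λ-adic Kato bound in the tree so far is typed INSIDE a reduction-specific package: the good
ORDINARY §17.13 package `Kato2004.DivisibilityInputs` (fields `es_bound`, `integral`; cell
`bsd-smallim`), its multiplicative twin `exists_multDivisibilityInputs_fine` (cell `bsd-stepL`), and —
for Kobayashi's supersingular `±`-theory at the quadratic character `η` — the two fields
`kato_rational` / `kato_integral` of `Kobayashi2003.EtaKatoColemanPoitouTateData` (seat k8q-c2x g0,
item 19241). The typing layer recorded the gap explicitly (`Kim2025/FineOneSidedDivisibility.lean`,
module docstring: "the non-ordinary case has no tree carrier, OPEN-QUESTIONS-09 Q12"). Kato's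
Thm. 13.4 is REDUCTION-FREE: it bounds `𝐇²(T)₀ = Ker(𝐇²(T) → 𝐇²_loc(T))` — whose `Δ`-trivial
component is the dual fine Selmer group `X₀(E/ℚ_∞)` — by the index of ANY Euler system, for any
`Gal(ℚ̄/ℚ)`-lattice `T` as in 13.1, under image hypotheses on `T` alone. This file types exactly that,
for `T = T_pW` and the tree's notion of a genuine Euler-system class. First consumer (kernel,
Summits-side, this seat): with the Coleman/Poitou–Tate package at `η` of Kobayashi 2003
(`Kobayashi2003.EtaColemanPoitouTateZetaData`, sibling file, whose `z` is pinned as an Euler-system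
class of the ADDITIVE twist `W = V ⊗ η`) it yields the two Kato fields of
`Kobayashi2003.EtaKatoColemanPoitouTateData`, hence Kobayashi Thm. 4.1 at `η` (item 19612) and the
Kato half (RK⁺) of the even main conjecture on the quadratic branch (item 19241) on every row where
Kato's hypothesis (v) holds for `W` — Kato's divisibility entering BY NAME from the `Kato2004` family
instead of being re-transcribed inside a Kobayashi structure.

## Source, verbatim (K. Kato, *p-adic Hodge theory and values of zeta functions of modular forms*,
## Astérisque 295 (2004) 117–290 [Kato2004Asterisque]; held copy `paper:url-37fbba0bb64a`, PDF page
## = printed page − 115, re-read by this seat 2026-08-27, pp. 220–222, 224–228)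

§12.2 (p. 220): "Let `T` be a finitely generated `ℤ_p`-module endowed with a continuous action of
`Gal(ℚ̄/ℚ)` which is unramified at almost all prime numbers. We denote for `q ∈ ℤ`
`𝐇^q(T) = lim←_n H^q(ℤ[ζ_{p^n}, 1/p], T)` […] `𝐇^q_loc(T) = lim←_n H^q(ℚ_p(ζ_{p^n}), T)`."
§13.1 (pp. 224–225): "Let `L` be a finite extension of `ℚ_p` and let `T` be a free `O_L`-module of
finite rank endowed with a continuous `O_L`-linear action of `Gal(ℚ̄/ℚ)` which is unramified at almost
all prime numbers. Let `Σ` be a finite set of prime numbers containing `p` and all prime numbers at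
which the action of `Gal(ℚ̄/ℚ)` on `T` ramifies, and let `Ξ = {m ≥ 1 ; prime(m) ∩ Σ = {p}}`. For a prime
number `ℓ` which is not contained in `Σ`, let `P_ℓ(t) = det_{O_L}(1 − Fr_ℓ⁻¹ t : T → T) ∈ O_L[t]` […]
By an Euler system for `(T, L, Σ)`, we mean a system of elements `z_m ∈ H¹(ℤ[ζ_m, 1/p], T)` defined
for `m ∈ Ξ`, satisfying the following condition. (13.1.1) For `m, m' ∈ Ξ` such that `m | m'`, the norm
map `H¹(ℤ[ζ_{m'}, 1/p], T) → H¹(ℤ[ζ_m, 1/p], T)` sends `z_{m'}` to `(∏_ℓ P_ℓ(Fr_ℓ⁻¹ σ_ℓ⁻¹)) · z_m`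
where `ℓ` ranges over all prime numbers which divide `m'` but do not divide `m` […]."
Ex. 13.3 (p. 225): "(the crucial example for this paper) […] `T = V_{O_λ}(f)(k − r)` […] Then `(z_m)_m`
is an Euler system for `(T, F_λ, Σ)`."
**Thm. 13.4** (p. 226): "By [Pe4, Ru4, KK4], we have — Let `(T, L, Σ)` be as in 13.1, and let `(z_m)_m`
be an Euler system for `(T, L, Σ)`. Let `Λ = O_L[[G_∞]]`, let `Z` be the `Λ`-submodule of `𝐇¹(T)`
generated by `(z_{p^n})_n`, and let `J` be the ideal of `Λ` generated by `h(Z)` for all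
`Λ`-homomorphisms `h : 𝐇¹(T) → Λ`. On the other hand, let `𝐇²(T)₀ = Ker(𝐇²(T) → 𝐇²_loc(T))`. Assume
the following (i)–(v). (i) `Z_q ≠ 0` for any prime ideal `q` of `Λ` of height `0`. (ii)
`rank_{O_L}(T⁺) = rank_{O_L}(T⁻) = 1`. (iii) There exists an integer `w` such that for any prime number
`ℓ` which is not contained in `Σ`, all eigenvalues of `Fr_ℓ` on the `L`-vector space `T ⊗_{O_L} L`
are algebraic numbers whose all complex conjugates have absolute value `ℓ^{w/2}`. (iv) `T ⊗_{O_L} L`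
is irreducible as a representation of `Gal(ℚ̄/ℚ)` over `L`. (v) There exists an element `σ` of
`Gal(ℚ̄/ℚ(ζ_{p^∞}))` such that `dim_L(Coker(1 − σ ; T ⊗_{O_L} L → T ⊗_{O_L} L)) = 1`. Then we have:
(1) `𝐇²(T)` is a torsion `Λ`-module. (2) Let `𝔭` be a prime ideal of `Λ` of height one which does not
contain `p`. Then `length_{Λ_𝔭}(𝐇²(T)_{0,𝔭}) ≤ length_{Λ_𝔭}(Λ_𝔭/J_𝔭)`. (3) Assume that there exists
an element `σ` of `Gal(ℚ̄/ℚ(ζ_{p^∞}))` such that `Coker(1 − σ : T → T)` is a free `O_L`-module of rank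
`1`, and assume that `T ⊗_{O_L} O_L/m_L` is irreducible as a representation of `Gal(ℚ̄/ℚ)` over
`O_L/m_L`. Assume further `p ≠ 2`. Then `length_{Λ_𝔭}(𝐇²(T)_{0,𝔭}) ≤ length_{Λ_𝔭}(Λ_𝔭/J_𝔭)` for
any prime ideal `𝔭` of `Λ` of height one. In the case of 13.3, the conditions (ii), (iii), (iv) in
Thm. 13.4 are satisfied ((iii) is due to Deligne [Del], and (iv) is due to Ribet [Ri1]). However if
`f` has CM, this theorem is not applied because the condition (v) is not satisfied in the CM case."
Prop. 13.7 (p. 227): "Define `Z ⊂ 𝐇¹(V_{O_λ}(f))` as in Thm. 12.6. Then `Z_q ≠ 0` for any prime ideal `q`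
of `Λ` of height `0`." Thm. 12.4 (2) (p. 221): "`𝐇¹(T)` is a torsion free `Λ`-module, and `𝐇¹(T) ⊗ ℚ`
[…] is a free `Λ ⊗ ℚ`-module of rank 1."
The `ℚ_∞`-form of the same bound, for any `Λ`-adic Kolyvagin system (in particular the image of any
Euler system under the Euler-to-Kolyvagin map) and the dual fine Selmer group on the nose, is printed
as C.-H. Kim, Amer. J. Math. 148 (2026), Thm. 4.7 (1) [Kim2022StructureSelmer] (held
`paper:arxiv-2203.12159` p0020): "(Mazur–Rubin) Let `κ^∞ ∈ KS(T ⊗ Λ)` be a `Λ`-adic Kolyvagin system.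
`char_Λ(H¹_Iw(ℚ, T)/Λκ^∞_1) ⊆ char_Λ(Sel₀(ℚ_∞, E[p^∞])^∨)`" (standing hypotheses of loc. cit. §1.2.5:
`p ≥ 5`, `ρ̄_{E,p}` surjective; `H¹_Iw(ℚ, T) = lim←_m H¹(ℚ_m, T)`, §1.2.3 — the tree's pin of
`IwasawaH1Data`), with Thm. 4.6 (2) ibid.: "`Sel_{𝓕*_Λ}(ℚ, (T ⊗ Λ)*) = Sel₀(ℚ_∞, E[p^∞])` is a
co-finitely generated co-torsion `Λ`-module" [Kato].

## Transcription — binders, the two clauses, and the reading flags (for the referee)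

Binders: `W/ℚ` ANY elliptic curve (any reduction at `p`; the structure facts
`ContinuousSMul / Module.Free / Module.Finite ℤ_[p] (T_pW)` are instance BINDERS, discharged by the
tree theorems `TateModule.continuousSMul_padicInt`, `module_free_tateModule_holds`,
`module_finite_tateModule_holds` — convention of `EulerSystemValues.tateRep` /
`IsEulerSystemClass`); `p ≠ 2`; `κ` the cyclotomic `ℤ_p`-extension of `ℚ` with topological generator
`γ` (the pins of `I` and `FB`); `I : IwasawaH1Data W p κ γ`; `FB : W.FineSelmerDualData κ γ`;
`s : I.H` a genuine Euler-system class (`IsEulerSystemClass`: `s` is, layer by layer, the trace to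
`ℚ_n` of the level-`ℚ(μ_{p^{n+1}})` class of an INTEGRAL Euler system for `T_pW` over the cyclotomic
levels — Kato's `(z_{p^n})_n` of Thm. 13.4 projected to the `Δ`-trivial component) with `s ≠ 0`
(hypothesis (i), flag `Kato-134-i-Delta-trivial` below) and Kato's hypothesis (v) spelled on `T_pW`:
some `σ ∈ Γ_ℚ` fixing every `p`-power root of unity of `ℚ̄` (`σ ∈ Gal(ℚ̄/ℚ(ζ_{p^∞}))`, the spelling of
`Kato2004.ImageContainsSL2`) has `Coker(ρ(σ) − 1 : T_pW → T_pW)` of `ℤ_p`-rank `1`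
(`Module.finrank ℤ_[p] (T ⧸ range(ρ σ − 1)) = 1`, i.e. `dim_{ℚ_p} Coker(1 − σ; V_pW) = 1`). Hypotheses
(ii)–(iv) are DISCHARGED IN PRINT for `T = T_pW` ("In the case of 13.3, the conditions (ii), (iii),
(iv) in Thm. 13.4 are satisfied": `T_pW = V_{ℤ_p}(f_W)(1)` is the case `k = 2`, `r = 1` of Ex. 13.3,
14.10 p. 241) and are therefore not binders. Conclusions, both in Kato's printed LENGTH form
(junk-free: if `I.H ⧸ Λs` is not torsion at `𝔭` the right-hand side is `⊤`):
* clause (2): for every height-one prime `𝔭` of `Λ` with `p ∉ 𝔭`,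
  `ℓ_𝔭(X₀(W/ℚ_∞)) ≤ ℓ_𝔭(𝐇¹_Γ(T_pW)/Λs)`;
* clause (3): if moreover `W[p]` is irreducible (`W.HasIrreducibleModPGaloisRep p` = "`T ⊗ O_L/m_L`
  irreducible") and some `σ ∈ Gal(ℚ̄/ℚ(ζ_{p^∞}))` has `Coker(ρ(σ) − 1 : T_pW → T_pW)` FREE of rank `1`
  (VERBATIM the conclusion shape of the tree theorem
  `Kato2004.exists_quotient_range_sub_one_equiv_of_imageContainsSL2`, so (12.5.2) discharges it), then
  the same inequality holds at EVERY height-one prime `𝔭`.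
READING FLAGS. `Kato-134-H20-fine`: the `Δ`-trivial component of `𝐇²(T_pW)₀ = Ker(𝐇²(T) → 𝐇²_loc(T))`
is read as the dual fine Selmer group `X₀(W/ℚ_∞) = FB.X` — by Poitou–Tate duality along the tower,
`Ker(H²(ℤ[ζ_{p^n}, 1/p], T) → H²(ℚ_p(ζ_{p^n}), T))` is dual to the classes of `H¹(ℤ[ζ_{p^n}, 1/p],
E[p^∞])` vanishing at `p`, and over `K_∞ = ℚ(ζ_{p^∞})` "unramified at `v ∤ p`" is "locally trivial at
`v ∤ p`" for `p`-primary classes (the residual Galois group of `K_{∞,w}` is prime to `p`), so the limit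
is Kobayashi's `X⁰(E/K_∞)` of Def. 2.1 and its `Δ`-trivial component is `X₀(E/ℚ_∞)` — Kobayashi 2003
Prop. 7.1 ii) (Kurihara) in the supersingular case (there `𝐇²_loc = 0`), Kim AJM 148 Thm. 4.6 (2) for
the `Λ = ℤ_p⟦Gal(ℚ_∞/ℚ)⟧`-form; the same reading as the fields `kato_rational`/`kato_integral` of
`Kobayashi2003.EtaKatoColemanPoitouTateData` and as `Y` in `DivisibilityInputsFine`; NOT formalised
(there is no `𝐇²` object in the tree: `IwasawaH2Data.H2`, `DivisibilityInputs.H2` are abstract).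
`Kato-134-J-quotient`: `ℓ_𝔭(Λ_𝔭/J_𝔭)` is read as `ℓ_𝔭(𝐇¹_Γ/Λs)`: `𝐇¹(T)` is torsion free of rank one
(Thm. 12.4 (2); tree: `IwasawaH1Data.noZeroSMulDivisors`, rank `≤ 1` proved), so at a height-one `𝔭`
the localisation `𝐇¹_𝔭` is free of rank one over the discrete valuation ring `Λ_𝔭`, `J_𝔭` is the
ideal of `Z_𝔭 ⊂ 𝐇¹_𝔭 ≅ Λ_𝔭`, and `Λ_𝔭/J_𝔭 ≅ (𝐇¹/Z)_𝔭`; on the `Δ`-trivial factor `Z` is `Λs`.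
`Kato-134-i-Delta-trivial`: hypothesis (i) ("`Z_q ≠ 0` for every height-0 prime `q` of `O_L[[G_∞]]`",
i.e. every `Δ`-component of the `Λ`-adic class non-zero) is recorded on the `Δ`-trivial component
only, as `s ≠ 0` (`𝐇¹_Γ` is torsion free). This is implied by, never stronger than, the print: given
an Euler system `z` whose `Δ`-trivial class is `s ≠ 0`, the spliced system `e₀ z + Σ_{η ≠ 1} e_η z^{(η)}`
(`e_η ∈ ℤ_p[Δ] ⊂ Λ` the idempotents, `p − 1 ∈ ℤ_p^×`; `z^{(η)}` generators of Kato's own Euler system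
of Thm. 12.6 / Ex. 13.3 for `T_pW` with non-zero `η`-component, which exist by Prop. 13.7; `Λ`-linear
combinations of Euler systems for `T` are Euler systems, (13.1.1) being `O_L[Gal]`-linear) satisfies
(i) and has the same `Δ`-trivial class `s`, and Thm. 13.4 (2)(3) at the primes of the `Δ`-trivial
factor only see that class; it is also the form in which the `ℚ_∞`-versions are printed (Rubin,
*Euler Systems* (2000) §2.3, hypothesis "`c_{ℚ,∞} ∉ H¹_∞(ℚ,T)_{tors}`"; Kim AJM 148 Thm. 4.7 (1), no
such hypothesis at all). `Kato-134-levels`: the tree's `IsEulerSystem (cyclotomicLevelsRat p S)` asks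
for classes on ALL levels `ℚ(μ_{p^k})·∏_{q∈r}ℚ(μ_q)`, `k ≥ 0`, with Rubin's norm relations = Kato's
(13.1.1) (`EulerSystemValues` module docstring); Kato's `Ξ` (`p ∣ m`) is a subfamily, so the tree's
hypothesis is stronger and the fact weaker than print. Everything recorded is implied by, never
stronger than, the print.

## What is NOT here (and why)

* NO clause for CM curves beyond what (v) allows ("if `f` has CM, this theorem is not applied because
  the condition (v) is not satisfied"): Kato's bound for CM forms is Thm. 12.5 (3)(4) for his ZETA
  elements via §15, not a statement about arbitrary Euler systems; it is not transcribed here.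
* NO Thm. 13.4 (1) (`𝐇²(T)` torsion = Thm. 12.4 (1), see `IwasawaH2Data.isTorsion_H2`), no `𝐇²` object,
  no identification of `s` with a zeta element, no `p`-adic `L`-function, no Coleman map — the fact is
  about a bare Euler-system class; the link `Col⁺(s) = L_p⁺` at `η` is Kobayashi's Thm. 6.3 (sibling
  file `Kobayashi2003/EtaColemanPoitouTateZetaSequences.lean`).
* NO main [C] (Conj. 12.10, the converse inequality) is asserted.

## READING NOTE (added 2026-08-28, doc-only; the declarations of this file are UNCHANGED)

`Kato-134-dual-action`: the fact below pins the dual fine Selmer group as `FB : W.FineSelmerDualData κ γ`,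
whose `T` acts on `Hom(Sel₀(ℚ_∞, E[p^∞]), ℚ/ℤ)` by PRE-composition with `conj_γ`
(`FineSelmerDualData.toDual_T_smul`), while `I : IwasawaH1Data W p κ γ` carries Kato's natural
(covariant) action `T = conj_γ − 1` (`IwasawaH1Data.proj_T_smul`; Kato §12.2). Poitou–Tate duality,
being functorial (transport of structure), carries the natural action on `𝐇²(T)₀` to the CONTRAGREDIENT
action `x ↦ x ∘ conj_{γ⁻¹}` on the Pontryagin dual, so with `1 + T ↦ γ` on both sides Kato's `𝐇²(T)₀` is
the datum `W.FineSelmerDualData κ γ⁻¹`, and the inequalities (2)(3) below read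
`ℓ_{ι𝔭}(X₀) ≤ ℓ_𝔭(𝐇¹/Λs)` (`ι(γ) = γ⁻¹`, Greenberg's `S^ι` [Greenberg1989, pp. 101–102]) — Kato's Thm.
13.4 (2)(3) composed with `ι` on ONE side; they coincide with the print only granted the unprinted
statement «`char_Λ(𝐇¹(T_pW)/Λs)` is `ι`-symmetric prime by prime» (convention audit of the cell
`bsd-wall`, crux `SignedKatoDivisibilityUpToAtTwo`, `G4-CONVENTION-AUDIT.md` + second reader, 2026-08-28,
which names this fact). The PRINT-EXACT reading (same `𝔭` on both sides, `FB` over `γ⁻¹`) is the sibling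
named fact `Kato2004.thm13_4_lengthAt_fineSelmerDualContra_le_of_isEulerSystemClass` (file
`Kato2004/EulerSystemBoundFineSelmerContragredient.lean`; derivation and verbatim sources in the module
docstring of `Kato2004/EulerSystemBoundFineSelmerTwoContragredient.lean`). This fact is kept VERBATIM
(D-0014: a fact's meaning is never changed in place; existing consumers are untouched).

References: [Kato2004Asterisque] §12.2 (p. 220), Thm. 12.4 (2) (p. 221), Thm. 12.5–12.6 (pp. 221–222),
§13.1 (13.1.1), Ex. 13.2–13.3 (pp. 224–225), Thm. 13.4 (p. 226), Prop. 13.7 (p. 227), §13.8 (p. 228),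
14.10 (p. 241); [Kim2022StructureSelmer] §1.2.3–1.2.5, Thm. 4.6, Thm. 4.7 (AJM 148 (2026); arXiv
2203.12159 pp. 5, 20); [Rubin2000] K. Rubin, *Euler Systems*, Ann. of Math. Stud. 147, §2.3 (the
`ℚ_∞`-form; not held — cited after Kato's [Ru4]); [Kobayashi2003] Def. 2.1 (p. 5), Prop. 7.1 ii)
(p. 12); [MazurRubin2004] Thm. 5.3.10; [Greenberg1989] §0 pp. 101–102; tree `Kato2004/{IwasawaCohomology,
EulerSystemClasses, DivisibilityInputs, Condition1252, EulerSystemBoundFineSelmerContragredient}.lean`,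
`KatoFineSelmerDual.lean`, `Kim2025/FineOneSidedDivisibility.lean`.
-/

noncomputable section

open scoped NumberField
open Field
open Literature.NumberTheory.GaloisRepresentations
open Literature.NumberTheory.EllipticCurves Literature.NumberTheory.EllipticCurves.Kato2004.EulerSystemValues

namespace Literature.NumberTheory.EllipticCurves.Kato2004

/-! ## The named fact: Thm. 13.4 (2)(3) for `T = T_pW`, on the pinned `(𝐇¹_Γ(T_pW), X₀(W/ℚ_∞))` -/

/-- **Kato 2004, Thm. 13.4 (2)(3) for `T = T_pW` (Ex. 13.3 with `k = 2`, `r = 1`), read on the dual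
fine Selmer group.** For every elliptic curve `W/ℚ` (ANY reduction at `p`; structure facts of `T_pW` as
instance BINDERS), every odd prime `p`, the cyclotomic `ℤ_p`-extension `κ` with topological generator
`γ`, every pinned `I : IwasawaH1Data W p κ γ` (`𝐇¹_Γ(T_pW)`) and `FB : W.FineSelmerDualData κ γ`
(`X₀(W/ℚ_∞)`), and every GENUINE Λ-adic Euler-system class `s ∈ 𝐇¹_Γ(T_pW)`
(`IsEulerSystemClass W p κ γ I s`: the `Δ`-trivial projection of `(z_{p^n})_n` for an integral Euler
system `z` of `T_pW` over the cyclotomic levels) with `s ≠ 0` (hypothesis (i), flag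
`Kato-134-i-Delta-trivial`) and Kato's hypothesis (v) on `T_pW` (some `σ ∈ Gal(ℚ̄/ℚ(ζ_{p^∞}))` with
`Coker(ρ(σ) − 1 : T_pW → T_pW)` of `ℤ_p`-rank `1`; (ii)–(iv) hold in print for `T_pW`):
* (2) at every height-one prime `𝔭 ∌ p` of `Λ = ℤ_p⟦X⟧`: `ℓ_𝔭(X₀(W/ℚ_∞)) ≤ ℓ_𝔭(𝐇¹_Γ(T_pW)/Λs)`
  ("`length_{Λ_𝔭}(𝐇²(T)_{0,𝔭}) ≤ length_{Λ_𝔭}(Λ_𝔭/J_𝔭)`", flags `Kato-134-H20-fine`,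
  `Kato-134-J-quotient`);
* (3) if `W[p]` is irreducible and some `σ ∈ Gal(ℚ̄/ℚ(ζ_{p^∞}))` has `Coker(ρ(σ) − 1)` FREE of rank `1`
  over `ℤ_p` (the shape produced from (12.5.2) by
  `Kato2004.exists_quotient_range_sub_one_equiv_of_imageContainsSL2`), the same inequality at EVERY
  height-one prime `𝔭`.
Length form = Kato's print (no `charIdeal` junk: a non-torsion quotient has local length `⊤`). Named
fact; nothing asserted; weaker than print (module docstring, flags `Kato-134-levels`,
`Kato-134-i-Delta-trivial`); no `_holds` (the Euler-system machinery of §13 is not in Mathlib). NOT a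
statement about CM curves beyond hypothesis (v) (Kato: "(v) is not satisfied in the CM case").
[cite: Kato2004Asterisque, Thm. 13.4 (p. 226), §13.1 (13.1.1) and Ex. 13.3 (pp. 224–225), Prop. 13.7 (p. 227), §12.2 (p. 220), Thm. 12.4 (2) (p. 221), 14.10 (p. 241)]
[cite: Kim2022StructureSelmer, Thm. 4.7 (1) and Thm. 4.6 (2), §1.2.3–1.2.5 (the ℚ_∞-form on Sel₀(ℚ_∞, E[p^∞])^∨; arXiv 2203.12159 pp. 5, 20)]
[cite: Kobayashi2003, Def. 2.1 (p. 5) and Prop. 7.1 ii) (p. 12) (X⁰ and 𝐇²; reading)] -/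
def thm13_4_lengthAt_fineSelmerDual_le_of_isEulerSystemClass : Prop :=
  ∀ (W : WeierstrassCurve ℚ) [W.IsElliptic] (p : ℕ) [Fact p.Prime]
    [ContinuousSMul ℤ_[p] (W.tateModule p)] [Module.Free ℤ_[p] (W.tateModule p)]
    [Module.Finite ℤ_[p] (W.tateModule p)]
    (κ : ZpExtension ℚ p) (γ : absoluteGaloisGroup ℚ),
    p ≠ 2 → κ.IsCyclotomic → κ.IsTopGenerator γ →
  ∀ (I : IwasawaH1Data W p κ γ) (FB : W.FineSelmerDualData κ γ) (s : I.H),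
    IsEulerSystemClass W p κ γ I s → s ≠ 0 →
    -- hypothesis (v) of Thm. 13.4 for `T = T_pW`
    (∃ σ : absoluteGaloisGroup ℚ,
      (∀ (n : ℕ) (t : AlgebraicClosure ℚ), t ^ p ^ n = 1 → σ • t = t) ∧
        Module.finrank ℤ_[p]
          ((W.tateModule p) ⧸ LinearMap.range (W.galoisRepTate p σ - 1)) = 1) →
    -- (2): at the height-one primes `𝔭 ∌ p`
    (∀ 𝔭 : PrimeSpectrum (IwasawaAlgebra p), 𝔭.asIdeal.height = 1 →
      PowerSeries.C (p : ℤ_[p]) ∉ 𝔭.asIdeal →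
        Module.lengthAt (IwasawaAlgebra p) FB.X 𝔭 ≤
          Module.lengthAt (IwasawaAlgebra p) (I.H ⧸ Submodule.span (IwasawaAlgebra p) {s}) 𝔭) ∧
    -- (3): under `W[p]` irreducible and a `σ` with `Coker(ρ σ − 1)` free of rank one, at EVERY
    -- height-one prime
    (W.HasIrreducibleModPGaloisRep p →
      (∃ σ : absoluteGaloisGroup ℚ,
        (∀ (n : ℕ) (t : AlgebraicClosure ℚ), t ^ p ^ n = 1 → σ • t = t) ∧
          Nonempty (((W.tateModule p) ⧸ LinearMap.range (W.galoisRepTate p σ - 1)) ≃ₗ[ℤ_[p]]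
            ℤ_[p])) →
      ∀ 𝔭 : PrimeSpectrum (IwasawaAlgebra p), 𝔭.asIdeal.height = 1 →
        Module.lengthAt (IwasawaAlgebra p) FB.X 𝔭 ≤
          Module.lengthAt (IwasawaAlgebra p) (I.H ⧸ Submodule.span (IwasawaAlgebra p) {s}) 𝔭)

-- TODO(general form): Kato's Thm. 13.4 for an arbitrary free `O_L`-lattice `T` as in 13.1 (any
-- `(T, L, Σ)` satisfying (ii)–(v)), all `Δ`-components of `𝐇²(T)₀` over `Λ = O_L[[G_∞]]`, and the
-- bound by `Λ/J` for a not necessarily cyclic `Z`; here only `T = T_pW`, the `Δ`-trivial component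
-- and a cyclic `Z = Λs`.

end Literature.NumberTheory.EllipticCurves.Kato2004

end
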